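import Summits.BirchSwinnertonDyer.BirchSwinnertonDyer.Theorems.ManinLocalTwoThreeShimuraThreeTorsionAtNine
import Summits.BirchSwinnertonDyer.BirchSwinnertonDyer.Theorems.ManinLocalTwoThreeShimuraIndexMuThree
import Summits.BirchSwinnertonDyer.Rank1Residual.ManinAdditive.ShimuraCuspLifting
import HarnessLib

/-!
# E-an-221 IS A COROLLARY OF THE CUSP-LIFTING LAW E-an-128 — the Shimura stub of RES₃♭ is the cell's own (older) paper theorem
(route `ManinLocalTwoThree`, crux C3 `ManinPrimeToThreeAtNine` stmt-BirchSwinnertonDyer-22968; cell bsd-f2-manin, lens `an`, planner an g40,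
MEMO-an §84; proposed Theorems target `…/Theorems/ManinLocalTwoThreeShimuraThreeTorsionOfCuspLifting.lean`, `--supports stmt-BirchSwinnertonDyer-22968`)

CONTENT.  The C3 skeleton v30 (LEAD p1 g16, `…ShimuraThreeTorsionAtNine`, p737849) reads RES₃♭ ⟸ EXISTC (theorem) ∧ (BI)_K ∧ (AN)_K ∧ E-an-221,
with E-an-221 `ShimuraThreeTorsion.ShimuraThreeKernelForcesRationalThreeTorsionAtNine` («lattice-optimal `W`, `9 ∣ N`, a Kummer–Shimura lift
`u` of a point of order `3` ⟹ a rational point of order `3` on `E_{W,c}`», an g39, p737356) filed as a fresh cell conjecture.  It is not fresh: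
**E-an-221 ⟸ E-an-128** `KatoCurve.ShimuraThreeForcesRationalThreeTorsion` (the CUSP-LIFTING LAW, an g27 MEMO-an §69.2, landed
`…ManinAdditive.ShimuraCuspLifting` p655552; THEOREM ON PAPER with two independent paper proofs — the torsor comparison of MEMO-an §69.2 and es's
THEOREM Θ «explicit reciprocity at the cusp» MEMO-es §34 / `…ManinAdditive.ShimuraCuspAnnihilator`; REF1 audit R-an-49 PASS §R77, 6/6 survive;
census E21 1025/1025), by PURE LATTICE ALGEBRA, kernel-checked here (§1–§2), at EVERY level (the `9 ∣ N` binder of E-an-221 is not used):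
  (DICTΣ, tree theorem `kummerShimuraLattice_holds`) a Kummer–Shimura lift `u ∉ Λ_E`, `3u ∈ Λ_E = c·Λ₀(f)` puts `Λ₁(f)` inside the index-`3` line
  `L_u = ℤ·(3u/c) + 3Λ₀(f)`; if `Λ₀/Λ₁` had no `3`-torsion (`ShimuraIndexPrimeTo 3 f`), then from `φ(N)·Λ₀ ⊆ Λ₁` (tree, Ling–Oesterlé §1) and
  `φ(N) = 3ᵃ·m`, `3 ∤ m`, every `x ∈ Λ₀` has `m·x ∈ Λ₁ ⊆ L_u` (`natMul_mem_of_shimuraIndexPrimeTo`), hence `x ∈ L_u` (Bézout, `L_u ⊇ 3Λ₀`), i.e.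
  `Λ₀ ⊆ L_u` — impossible for a rank-`2` lattice (`𝔽₃`-coordinates on the Néron basis, `PeriodPair.intCast_pair_eq_zero`).  So `3 ∣ [Λ₀(f) : Λ₁(f)]`
  and E-an-128 yields the rational point of order `3`.
CONSEQUENCES (all PROVED here, by name).  §2: `shimuraThreeKernelForcesRationalThreeTorsionAtNine_of_cuspLifting : E-an-128 → E-an-221`;
`…_of_muThreeShimura` : (the `μ₃`-Shimura residual of `shimuraThreeForcesRationalThreeTorsion_of_muThree`, LEAD p1 g9) → E-an-221;
`…_of_sharp_of_phi : E-es-67♯ → E-es-70 → E-an-221` (es's plus-index laws, `9 ∣ N` used here); `…_iff_muThree` : E-an-221 ⟺ its restriction to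
`μ₃`-carriers `HasShortMuThree W c` (the non-`μ₃` case is the tree's Katz/Ribet dichotomy
`exists_isShortThreeTorsion_or_hasShortMuThree_of_not_shimuraIndexPrimeTo_three`, unconditional).  §3: the C3 nets
`noRationalThreeTorsionCoprimeIsolatedResidual_of_kPieces_cuspLifting : EXISTC → (BI)_K → (AN)_K → E-an-128 → RES₃♭` (proposed v31: the stub
E-an-221 is REPLACED by the older, level-free, audited node E-an-128 — one conjecture node fewer in the cell's inventory), `…_of_kPieces_muThreeShimura`,
`…_of_kPieces_sharp_of_phi`.
HONEST FRAMING.  CONDITIONAL reductions only: E-an-128 / E-es-67♯ / E-es-70 are cell LAWS (theorems on paper: MEMO-an §69.2, MEMO-es §33.2; E-es-67♯ follows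
from E-an-128 by the tree edge `plusIndexPrimeToThreeOfMuThreeNoRationalThreeTorsion_of_cuspLifting`), OPEN in Lean (the torsor / diamond-operator
argument needs `X₁(N) → X₀(N)` as curves over `ℚ`, absent from the tree); (BI)_K, (AN)_K are open K-pieces (p2/p3).  RES₃♭, C3, Manin's conjecture and
BSD are NOT proved by this.  Nearest print for E-an-221/E-an-128 at `9 ∣ N`: none (Vatsal 2005 Thm 1.1 / Prop 5.3 need `ℓ² ∤ N`; Byeon–Yhee 2013 Thm 1.1
square-free; Agashe 2025 Thm 1.2 semistable; REF1 §R189: E-an-221 = Stein–Watkins (B) ⟹ (A) restricted and weakened, open in print at `9 ∣ N`).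
No definitions, no sorry, standard axioms.  PARTITION 0 · beyond-print theorem: the edge yes (kernel), the law E-an-128 yes on paper / no in Lean ·
BSD is not proved by this; Manin's conjecture is not proved by this.
[cite: LingOesterle1991, §1 and Thm. 1] [cite: Vatsal2005, Rem. 1.8, Thm. 1.17, Rem. 1.18 (shape)] [cite: Katz1980, Thm. 2 (m = ℓ)]
-/

set_option autoImplicit false
-- lint-debt: the directory name repeats the summit name (sibling precedent `ManinLocalTwoThreeShimuraThreeTorsionAtNine.lean`)
set_option linter.dupNamespace false

noncomputable section

open scoped Classical
open WeierstrassCurve Literature.NumberTheory.EllipticCurves Literature.NumberTheory.EllipticCurves.ModularForms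
open Summit.BirchSwinnertonDyer.Rank1Residual.ManinAdditive.CuspidalKummer
open Summit.BirchSwinnertonDyer.Rank1Residual.ManinAdditive.CuspidalKummerThree
open Summit.BirchSwinnertonDyer.Rank1Residual.ManinAdditive.UDCKummerLine
open Summit.BirchSwinnertonDyer.Rank1Residual.ManinAdditive.UDCKummerLineK
open Summit.BirchSwinnertonDyer.Rank1Residual.ManinAdditive.KatoCurve
open Summit.BirchSwinnertonDyer.Rank1Residual.ManinAdditive.ShimuraThreeTorsion

namespace Summit.BirchSwinnertonDyer.BirchSwinnertonDyer.Theorems.ManinLocalTwoThree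

/-! ### §1. Lattice algebra: a Kummer–Shimura lift forces `3 ∣ [Λ₀(f) : Λ₁(f)]` (every level) -/

section Lattice

variable {W : WeierstrassCurve ℚ} [W.IsElliptic] [W.IsGloballyMinimal] {N : ℕ} [NeZero N]

omit [W.IsElliptic] [W.IsGloballyMinimal] in
/-- A rank-`2` lattice is not cyclic modulo `3`: `Λ₀(f) ⊄ ℤ·(3u/c) + 3Λ₀(f)` whenever `3u ∈ Λ_E = c·Λ₀(f)` (the `𝔽₃`-coordinate argument of
`periodLatticeGamma1_ne_of_subset_line`, run on `Λ₀` itself). [folklore] -/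
theorem not_forall_mem_kummerLine (D : ModularParametrizationData W N)
    (hopt : ∀ z ∈ D.L.lattice, ∃ w ∈ periodLattice D.f, z = D.c * w) {u : ℂ} (hu₂ : 3 * u ∈ D.L.lattice) :
    ¬ ∀ x ∈ periodLattice D.f, ∃ k : ℤ, ∃ v ∈ periodLattice D.f, x = k * (3 * u / D.c) + 3 * v := by
  intro hline
  have hc := cast_c_ne_zero_of_latticeOptimal D hopt
  have hE : ∀ z ∈ D.L.lattice, ∃ k : ℤ, ∃ ℓ ∈ D.L.lattice, z = k * (3 * u) + 3 * ℓ := by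
    intro z hz
    obtain ⟨w, hw, rfl⟩ := hopt z hz
    obtain ⟨k, v, hv, rfl⟩ := hline w hw
    refine ⟨k, D.c * v, D.smul_periodLattice_le v hv, ?_⟩
    field_simp
  obtain ⟨a, b, hab⟩ := PeriodPair.mem_lattice.mp hu₂
  obtain ⟨k₁, ℓ₁, hℓ₁, h₁⟩ := hE _ D.L.ω₁_mem_lattice
  obtain ⟨k₂, ℓ₂, hℓ₂, h₂⟩ := hE _ D.L.ω₂_mem_lattice
  obtain ⟨m₁, n₁, hmn₁⟩ := PeriodPair.mem_lattice.mp hℓ₁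
  obtain ⟨m₂, n₂, hmn₂⟩ := PeriodPair.mem_lattice.mp hℓ₂
  have e₁ := PeriodPair.intCast_pair_eq_zero D.L (s := k₁ * a + 3 * m₁ - 1) (t := k₁ * b + 3 * n₁)
    (by push_cast; linear_combination (k₁ : ℂ) * hab + 3 * hmn₁ - h₁)
  have e₂ := PeriodPair.intCast_pair_eq_zero D.L (s := k₂ * a + 3 * m₂) (t := k₂ * b + 3 * n₂ - 1)
    (by push_cast; linear_combination (k₂ : ℂ) * hab + 3 * hmn₂ - h₂)
  obtain ⟨g₁, g₂⟩ := e₁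
  obtain ⟨g₃, g₄⟩ := e₂
  have h31 : (3 : ℤ) ∣ 1 := ⟨m₁ + n₂ - 3 * m₁ * n₂ + 3 * n₁ * m₂, by
    linear_combination (3 * n₂ - 1) * g₁ - (k₁ * a) * g₄ + (k₁ * b) * g₃ - (3 * m₂) * g₂⟩
  exact absurd h31 (by decide)

omit [W.IsElliptic] [W.IsGloballyMinimal] in
/-- Bézout descent on the Kummer line `L_u = ℤ·(3u/c) + 3Λ₀(f) ⊇ 3Λ₀(f)`: if `3 ∤ m` and `m·x ∈ L_u` for some `x ∈ Λ₀(f)`, then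
`x ∈ L_u`. [folklore] -/
theorem mem_kummerLine_of_natMul_mem (D : ModularParametrizationData W N) {u x : ℂ} (hx : x ∈ periodLattice D.f)
    {m : ℕ} (hm : ¬ 3 ∣ m) (h : ∃ k : ℤ, ∃ v ∈ periodLattice D.f, (m : ℂ) * x = k * (3 * u / D.c) + 3 * v) :
    ∃ k : ℤ, ∃ v ∈ periodLattice D.f, x = k * (3 * u / D.c) + 3 * v := by
  obtain ⟨k, v, hv, hkv⟩ := h
  obtain ⟨q, hq | hq⟩ : ∃ q : ℕ, m = 3 * q + 1 ∨ m = 3 * q + 2 := ⟨m / 3, by omega⟩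
  · subst hq
    refine ⟨k, v - (q : ℂ) * x, sub_mem hv ?_, ?_⟩
    · simpa [nsmul_eq_mul] using (periodLattice D.f).nsmul_mem hx q
    · push_cast at hkv
      linear_combination hkv
  · subst hq
    refine ⟨2 * k, 2 * v - (2 * (q : ℂ) + 1) * x, sub_mem ?_ ?_, ?_⟩
    · simpa [nsmul_eq_mul] using (periodLattice D.f).nsmul_mem hv 2
    · simpa [nsmul_eq_mul] using (periodLattice D.f).nsmul_mem hx (2 * q + 1)
    · push_cast at hkv ⊢
      linear_combination 2 * hkv

/-- **A Kummer–Shimura lift forces `3 ∣ [Λ₀(f) : Λ₁(f)]` (PROVED, every level `N`).**  For lattice-optimal `W` (`Λ_E = c·Λ₀(f)`) and `u ∉ Λ_E`,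
`3u ∈ Λ_E` with `KummerShimura D u` (every `Γ₁(N)`-Kummer period of `u` trivial), `Λ₀(f)/Λ₁(f)` has `3`-torsion: `¬ ShimuraIndexPrimeTo 3 D.f`.
(DICTΣ `kummerShimuraLattice_holds` + `φ(N)·Λ₀ ⊆ Λ₁` + the two lemmas above.) [cite: LingOesterle1991, §1 and Thm. 1] -/
theorem not_shimuraIndexPrimeTo_three_of_kummerShimura (D : ModularParametrizationData W N)
    (hopt : ∀ z ∈ D.L.lattice, ∃ w ∈ periodLattice D.f, z = D.c * w)
    {u : ℂ} (hu₁ : u ∉ D.L.lattice) (hu₂ : 3 * u ∈ D.L.lattice) (hS : KummerShimura D u) :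
    ¬ ShimuraIndexPrimeTo 3 D.f := by
  intro h
  have hline := kummerShimuraLattice_holds W D hopt u hu₁ hu₂ hS
  have hN : Nat.totient N ≠ 0 := (Nat.totient_pos.mpr (NeZero.pos N)).ne'
  obtain ⟨a, m, hm3, hφ⟩ := Nat.exists_eq_pow_mul_and_not_dvd hN 3 (by norm_num)
  refine not_forall_mem_kummerLine D hopt hu₂ fun x hx => ?_
  refine mem_kummerLine_of_natMul_mem D hx hm3 (hline _ ?_)
  refine natMul_mem_of_shimuraIndexPrimeTo h hx a m ?_
  rw [← hφ]
  exact totient_mul_mem_periodLatticeGamma1 D.f hx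

end Lattice

/-! ### §2. E-an-221 from the cusp-lifting law E-an-128, from its `μ₃`-Shimura residual, and from es's E-es-67♯ ∧ E-es-70 (PROVED edges) -/

/-- **E-an-128 ⟹ E-an-221 (PROVED; the `9 ∣ N` binder is not used).** [cite: Vatsal2005, Rem. 1.8, Thm. 1.17, Rem. 1.18 (shape)] -/
theorem shimuraThreeKernelForcesRationalThreeTorsionAtNine_of_cuspLifting (h128 : ShimuraThreeForcesRationalThreeTorsion) :
    ShimuraThreeKernelForcesRationalThreeTorsionAtNine := by
  intro W _ _ N _ D hopt _h9 u hu₁ hu₂ hS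
  exact h128 W D hopt (not_shimuraIndexPrimeTo_three_of_kummerShimura D hopt hu₁ hu₂ hS)

/-- **The `μ₃`-Shimura residual ⟹ E-an-221 (PROVED):** «a lattice-optimal `W` with `μ₃ ⊂ W` (`HasShortMuThree W c`) and no rational point of
order `3` on `E_{W,c}` has `3 ∤ [Λ₀(f) : Λ₁(f)]`» suffices (composition with the LEAD's `shimuraThreeForcesRationalThreeTorsion_of_muThree`).
[cite: Katz1980, Thm. 2 (m = ℓ)] -/
theorem shimuraThreeKernelForcesRationalThreeTorsionAtNine_of_muThreeShimura
    (hres : ∀ (W : WeierstrassCurve ℚ) [W.IsElliptic] [W.IsGloballyMinimal] {N : ℕ} [NeZero N]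
      (D : ModularParametrizationData W N),
      (∀ z ∈ D.L.lattice, ∃ w ∈ periodLattice D.f, z = D.c * w) →
      HasShortMuThree W D.c → (∀ X₀ Y₀ : ℚ, ¬ IsShortThreeTorsion W D.c X₀ Y₀) → ShimuraIndexPrimeTo 3 D.f) :
    ShimuraThreeKernelForcesRationalThreeTorsionAtNine :=
  shimuraThreeKernelForcesRationalThreeTorsionAtNine_of_cuspLifting (shimuraThreeForcesRationalThreeTorsion_of_muThree hres)

/-- **E-an-221 ⟺ its restriction to `μ₃`-carriers (PROVED):** the case `μ₃ ⊄ W` of E-an-221 is UNCONDITIONAL (Katz/Ribet dichotomy + §1).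
What remains open is exactly: lattice-optimal `W`, `9 ∣ N`, `μ₃ ⊂ W`, a Kummer–Shimura lift ⟹ a rational point of order `3`.
[cite: Katz1980, Thm. 2 (m = ℓ)] -/
theorem shimuraThreeKernelForcesRationalThreeTorsionAtNine_iff_muThree :
    ShimuraThreeKernelForcesRationalThreeTorsionAtNine ↔
      ∀ (W : WeierstrassCurve ℚ) [W.IsElliptic] [W.IsGloballyMinimal] {N : ℕ} [NeZero N]
        (D : ModularParametrizationData W N),
        (∀ z ∈ D.L.lattice, ∃ w ∈ periodLattice D.f, z = D.c * w) → 3 ^ 2 ∣ N → HasShortMuThree W D.c →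
        ∀ u : ℂ, u ∉ D.L.lattice → 3 * u ∈ D.L.lattice → KummerShimura D u → ∃ X Y : ℚ, IsShortThreeTorsion W D.c X Y := by
  constructor
  · intro h W _ _ N _ D hopt h9 _ u hu₁ hu₂ hS
    exact h W D hopt h9 u hu₁ hu₂ hS
  · intro h W _ _ N _ D hopt h9 u hu₁ hu₂ hS
    by_cases hμ : HasShortMuThree W D.c
    · exact h W D hopt h9 hμ u hu₁ hu₂ hS
    · by_contra hT
      push Not at hT
      rcases exists_isShortThreeTorsion_or_hasShortMuThree_of_not_shimuraIndexPrimeTo_three W D.isNewformOf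
          (not_shimuraIndexPrimeTo_three_of_kummerShimura D hopt hu₁ hu₂ hS) D.maninConstant_ne_zero_holds with ⟨X₀, Y₀, h'⟩ | hμ'
      · exact hT X₀ Y₀ h'
      · exact hμ hμ'

/-- **E-es-67♯ ∧ E-es-70 ⟹ E-an-221 (PROVED; here `9 ∣ N` IS used, by E-es-67♯).**  By `…_iff_muThree` only `μ₃`-carriers matter; on a
`μ₃`-carrier without rational `3`-torsion E-es-67♯ makes the plus index prime to `3` and THEOREM Φ′ (E-es-70) the Shimura index, contradicting §1.
[cite: Katz1980, Thm. 2 (m = ℓ)] [cite: LingOesterle1991, §1] -/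
theorem shimuraThreeKernelForcesRationalThreeTorsionAtNine_of_sharp_of_phi
    (h67s : PlusIndexPrimeToThreeOfMuThreeNoRationalThreeTorsion) (h70 : ShimuraIndexPrimeToOfPlusIndex) :
    ShimuraThreeKernelForcesRationalThreeTorsionAtNine := by
  refine shimuraThreeKernelForcesRationalThreeTorsionAtNine_iff_muThree.mpr ?_
  intro W _ _ N _ D hopt h9 hμ u hu₁ hu₂ hS
  by_contra hT
  push Not at hT
  exact not_shimuraIndexPrimeTo_three_of_kummerShimura D hopt hu₁ hu₂ hS
    (h70 W D 3 Nat.prime_three (by norm_num) (h67s W D hopt h9 hμ hT))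

/-! ### §3. The C3 nets: RES₃♭ ⟸ EXISTC ∧ (BI)_K ∧ (AN)_K ∧ E-an-128 (v31), and the two sibling forms (PROVED compositions) -/

/-- **NET v31 (PROVED): RES₃♭ ⟸ EXISTC ∧ (BI)_K ∧ (AN)_K ∧ E-an-128.** [folklore] -/
theorem noRationalThreeTorsionCoprimeIsolatedResidual_of_kPieces_cuspLifting
    (hEX : ReducibleShortThreeTorsionLiftC) (hBI : KummerCubeRootThreeBoundedK) (hAN : KummerCubeRootCongruenceOfBoundedK)
    (h128 : ShimuraThreeForcesRationalThreeTorsion) : NoRationalThreeTorsionCoprimeIsolatedResidual :=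
  noRationalThreeTorsionCoprimeIsolatedResidual_of_kPieces_sigmaTorsion hEX hBI hAN
    (shimuraThreeKernelForcesRationalThreeTorsionAtNine_of_cuspLifting h128)

/-- **Same with (AN)_K fed by UDC with algebraic-integer coefficients (all weights).** [folklore] -/
theorem noRationalThreeTorsionCoprimeIsolatedResidual_of_kPieces_cuspLifting_udc
    (hEX : ReducibleShortThreeTorsionLiftC) (hBI : KummerCubeRootThreeBoundedK)
    (hANofUDC : KummerCubeRootCongruenceOfBoundedKOfUDC) (hUDW : ∀ k : ℤ, UnboundedDenominatorsWeightAlgInt k)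
    (h128 : ShimuraThreeForcesRationalThreeTorsion) : NoRationalThreeTorsionCoprimeIsolatedResidual :=
  noRationalThreeTorsionCoprimeIsolatedResidual_of_kPieces_cuspLifting hEX hBI (hANofUDC hUDW) h128

/-- **RES₃♭ ⟸ EXISTC ∧ (BI)_K ∧ (AN)_K ∧ (the `μ₃`-Shimura residual) (PROVED).** [cite: Katz1980, Thm. 2 (m = ℓ)] -/
theorem noRationalThreeTorsionCoprimeIsolatedResidual_of_kPieces_muThreeShimura
    (hEX : ReducibleShortThreeTorsionLiftC) (hBI : KummerCubeRootThreeBoundedK) (hAN : KummerCubeRootCongruenceOfBoundedK)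
    (hres : ∀ (W : WeierstrassCurve ℚ) [W.IsElliptic] [W.IsGloballyMinimal] {N : ℕ} [NeZero N]
      (D : ModularParametrizationData W N),
      (∀ z ∈ D.L.lattice, ∃ w ∈ periodLattice D.f, z = D.c * w) →
      HasShortMuThree W D.c → (∀ X₀ Y₀ : ℚ, ¬ IsShortThreeTorsion W D.c X₀ Y₀) → ShimuraIndexPrimeTo 3 D.f) :
    NoRationalThreeTorsionCoprimeIsolatedResidual :=
  noRationalThreeTorsionCoprimeIsolatedResidual_of_kPieces_sigmaTorsion hEX hBI hAN
    (shimuraThreeKernelForcesRationalThreeTorsionAtNine_of_muThreeShimura hres)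

/-- **RES₃♭ ⟸ EXISTC ∧ (BI)_K ∧ (AN)_K ∧ E-es-67♯ ∧ E-es-70 (PROVED).** [cite: Katz1980, Thm. 2 (m = ℓ)] [cite: LingOesterle1991, §1] -/
theorem noRationalThreeTorsionCoprimeIsolatedResidual_of_kPieces_sharp_of_phi
    (hEX : ReducibleShortThreeTorsionLiftC) (hBI : KummerCubeRootThreeBoundedK) (hAN : KummerCubeRootCongruenceOfBoundedK)
    (h67s : PlusIndexPrimeToThreeOfMuThreeNoRationalThreeTorsion) (h70 : ShimuraIndexPrimeToOfPlusIndex) :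
    NoRationalThreeTorsionCoprimeIsolatedResidual :=
  noRationalThreeTorsionCoprimeIsolatedResidual_of_kPieces_sigmaTorsion hEX hBI hAN
    (shimuraThreeKernelForcesRationalThreeTorsionAtNine_of_sharp_of_phi h67s h70)

end Summit.BirchSwinnertonDyer.BirchSwinnertonDyer.Theorems.ManinLocalTwoThree

end
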